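import Summits.ValiantsHypothesis.ValiantsHypothesis.Theorems.SymPencilSingFiveClassification

/-!
# Route `SymPencil` — row `r = 11` of the size-`28` table, LEAF E AT FIVE SQUARES (tools):
# transport with fixed weights, the zero-weight reduction, the functional `θ` of a hyperplane of
# `W_col(0,1;3)` and its torus case
# (`--supports` stmt-ValiantsHypothesis-5674 `SdcSuperquadratic`; rung currency only)

Bookkeeping for the five-square replacement of leaf E (✓ `…SingFiveLeafWcol.wcolFive`), used by
`…WcolHyperplaneFive`:

* `jointFamily_map_prodCongr_weights` — row/column permutations transport a joint family with
  the SAME weights (`χ = 1` in ✓ `jointFamily_map`);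
* `jointFamily_four_of_zero_weight` — a zero weight leaves a joint family of four squares;
* `sing3_of_twoDeadRows` — two dead rows give `Sing3`;
* `exists_wcol_functional` — a `5`-dimensional `W ⊆ W_col(0,1;3)` is the hyperplane `θ^⊥`,
  `θ = (θ_a, θ_b) ≠ 0` on the live columns (the extraction of ✓ `wcolFive01`, verbatim);
* `vTorusType_of_wcol_functional` — `θ_a = 0` or `θ_b = 0` on the live columns ⇒ `VTorusType W`.

Honest framing: lemmas towards row `r = 11` (OPEN) of the size-`28` table; nothing about the
determinantal complexity of `per_4` is claimed here; stmt-5674 `SdcSuperquadratic` OPEN;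
`VP ≠ VNP` not moved.  No definitions, no named facts. [folklore]
-/

noncomputable section

-- single-conjunct layout: Sub = Summit, duplicated namespace component intended
set_option linter.dupNamespace false

namespace Summit.ValiantsHypothesis.ValiantsHypothesis.Theorems.SymPencilPerFourWcolHyperplaneFiveTools

open MvPolynomial Module Matrix
open Literature.Computability.AlgebraicComplexity
open Summit.ValiantsHypothesis.ValiantsHypothesis.Theorems
open Summit.ValiantsHypothesis.ValiantsHypothesis.Theorems.SymPencilSingSixClassification
open Summit.ValiantsHypothesis.ValiantsHypothesis.Theorems.SymPencilSingFiveClassification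

universe u

variable {K : Type u} [Field K]

/-! ## Transport and bookkeeping -/

/-- **Row/column permutations, weights kept.**  `Φ z = z ∘ (σ × τ)` preserves `per_4`, so a joint
family on `V` gives one on `Φ(V)` with the SAME weights. [folklore] -/
theorem jointFamily_map_prodCongr_weights {d : ℕ} (V : Submodule K (Fin 4 × Fin 4 → K))
    (σ τ : Equiv.Perm (Fin 4)) (c : Fin d → K)
    (β : Fin d → ((Fin 4 × Fin 4 → K) →ₗ[K] (Fin 4 × Fin 4 → K) →ₗ[K] K))
    (h : ∀ u : Fin 4 × Fin 4 → K, ∀ x ∈ V, ∃ e₀ e₁ : K, ∀ s : K,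
      eval (u + s • x) (perPoly (Fin 4) K) = e₀ + s * e₁ + s ^ 2 * ∑ k, c k * (β k u x) ^ 2) :
    ∃ β' : Fin d → ((Fin 4 × Fin 4 → K) →ₗ[K] (Fin 4 × Fin 4 → K) →ₗ[K] K),
      ∀ u : Fin 4 × Fin 4 → K,
        ∀ y ∈ V.map (LinearEquiv.funCongrLeft K K (Equiv.prodCongr σ τ)).toLinearMap,
        ∃ e₀ e₁ : K, ∀ s : K,
          eval (u + s • y) (perPoly (Fin 4) K) = e₀ + s * e₁ + s ^ 2 * ∑ k, c k * (β' k u y) ^ 2 := by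
  set Φ : (Fin 4 × Fin 4 → K) ≃ₗ[K] (Fin 4 × Fin 4 → K) :=
    LinearEquiv.funCongrLeft K K (Equiv.prodCongr σ τ) with hΦ
  have hΦper : ∀ z, eval (Φ z) (perPoly (Fin 4) K) = eval z (perPoly (Fin 4) K) :=
    fun z => SymPencilPerFourBlocks.eval_perPoly_comp_prodCongr σ τ z
  refine ⟨fun k => ((β k).comp Φ.symm.toLinearMap).compl₂ Φ.symm.toLinearMap, fun u => ?_⟩
  rintro _ ⟨x, hx, rfl⟩
  obtain ⟨e₀, e₁, he⟩ := h (Φ.symm u) x hx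
  refine ⟨e₀, e₁, fun s => ?_⟩
  have hu : u + s • Φ.toLinearMap x = Φ (Φ.symm u + s • x) := by
    rw [map_add, map_smul, LinearEquiv.apply_symm_apply]; rfl
  rw [hu, hΦper, he s]
  simp only [LinearMap.compl₂_apply, LinearMap.comp_apply, LinearEquiv.coe_coe,
    LinearEquiv.symm_apply_apply]

/-- **A zero weight**: a joint family of five squares with `c k₀ = 0` is a joint family of four
squares (reindex by `k₀.succAbove`). [folklore] -/
theorem jointFamily_four_of_zero_weight (V : Submodule K (Fin 4 × Fin 4 → K)) (c : Fin 5 → K)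
    (k₀ : Fin 5) (hk : c k₀ = 0)
    (β : Fin 5 → ((Fin 4 × Fin 4 → K) →ₗ[K] (Fin 4 × Fin 4 → K) →ₗ[K] K))
    (h : ∀ u : Fin 4 × Fin 4 → K, ∀ x ∈ V, ∃ e₀ e₁ : K, ∀ s : K,
      eval (u + s • x) (perPoly (Fin 4) K) = e₀ + s * e₁ + s ^ 2 * ∑ k, c k * (β k u x) ^ 2) :
    ∀ u : Fin 4 × Fin 4 → K, ∀ x ∈ V, ∃ e₀ e₁ : K, ∀ s : K,
      eval (u + s • x) (perPoly (Fin 4) K) = e₀ + s * e₁ +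
        s ^ 2 * ∑ k, (fun k => c (k₀.succAbove k)) k * ((fun k => β (k₀.succAbove k)) k u x) ^ 2 := by
  intro u x hx
  obtain ⟨e₀, e₁, he⟩ := h u x hx
  refine ⟨e₀, e₁, fun s => ?_⟩
  rw [he s, Fin.sum_univ_succAbove _ k₀, hk, zero_mul, zero_add]

/-- **Two dead rows ⇒ `Sing3`**: if only rows `p, q` are live on `W`, every `3 × 3` subpermanent
vanishes on `W` (one of its three rows is dead). [folklore] -/
theorem sing3_of_twoDeadRows (W : Submodule K (Fin 4 × Fin 4 → K)) (p q : Fin 4)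
    (hcol : ∀ x ∈ W, ∀ i j : Fin 4, i ≠ p → i ≠ q → x (i, j) = 0) : Sing3 W := by
  classical
  intro x hx r cc hr _
  obtain ⟨i, hip, hiq⟩ : ∃ i : Fin 3, r i ≠ p ∧ r i ≠ q := by
    by_contra h
    push Not at h
    have h01 : r 0 ≠ r 1 := fun e => absurd (hr e) (by decide)
    have h02 : r 0 ≠ r 2 := fun e => absurd (hr e) (by decide)
    have h12 : r 1 ≠ r 2 := fun e => absurd (hr e) (by decide)
    by_cases e0 : r 0 = p
    · have e1 : r 1 = q := h 1 fun e => h01 (e0.trans e.symm)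
      have e2 : r 2 = q := h 2 fun e => h02 (e0.trans e.symm)
      exact h12 (e1.trans e2.symm)
    · have e0' : r 0 = q := h 0 e0
      by_cases e1 : r 1 = p
      · have e2 : r 2 = q := h 2 fun e => h12 (e1.trans e.symm)
        exact h02 (e0'.trans e2.symm)
      · exact h01 (e0'.trans (h 1 e1).symm)
  have hrow : ∀ j, x (r i, cc j) = 0 := fun j => hcol x hx _ _ hip hiq
  unfold Matrix.permanent
  refine Finset.sum_eq_zero fun σ _ => ?_
  exact Finset.prod_eq_zero (Finset.mem_univ (σ.symm i))
    (by simp [Matrix.submatrix_apply, Matrix.of_apply, hrow])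

/-! ## The hyperplane `θ^⊥` of `W_col(0,1;3)` -/

/-- **The functional.**  A `5`-dimensional `W ⊆ W_col(0,1;3)` is `{x ∈ W_col(0,1;3) : Σ θ_{a,j}
x_{0j} + Σ θ_{b,j} x_{1j} = 0}` for some `θ = (θ_a, θ_b) ≠ 0` on the live columns (extraction as
in ✓ `wcolFive01`). [folklore] -/
theorem exists_wcol_functional (W : Submodule K (Fin 4 × Fin 4 → K)) (h5 : finrank K W = 5)
    (hWc : ∀ x ∈ W, (∀ j, x (2, j) = 0) ∧ (∀ j, x (3, j) = 0) ∧ x (0, 3) = 0 ∧ x (1, 3) = 0) :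
    ∃ θa θb : Fin 4 → K,
      ¬ (θa 0 = 0 ∧ θa 1 = 0 ∧ θa 2 = 0 ∧ θb 0 = 0 ∧ θb 1 = 0 ∧ θb 2 = 0) ∧
      (∀ x ∈ W, θa 0 * x (0, 0) + θa 1 * x (0, 1) + θa 2 * x (0, 2) +
        (θb 0 * x (1, 0) + θb 1 * x (1, 1) + θb 2 * x (1, 2)) = 0) ∧
      (∀ x : Fin 4 × Fin 4 → K, (∀ j, x (2, j) = 0) → (∀ j, x (3, j) = 0) → x (0, 3) = 0 →
        x (1, 3) = 0 → θa 0 * x (0, 0) + θa 1 * x (0, 1) + θa 2 * x (0, 2) +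
          (θb 0 * x (1, 0) + θb 1 * x (1, 1) + θb 2 * x (1, 2)) = 0 → x ∈ W) := by
  classical
  have hLcard : (Finset.univ.filter fun p : Fin 4 × Fin 4 => (p.1 = 0 ∨ p.1 = 1) ∧ p.2 ≠ 3).card
      = 6 := by decide
  have hLcases : ∀ p ∈ (Finset.univ.filter fun p : Fin 4 × Fin 4 => (p.1 = 0 ∨ p.1 = 1) ∧ p.2 ≠ 3),
      p = (0, 0) ∨ p = (0, 1) ∨ p = (0, 2) ∨ p = (1, 0) ∨ p = (1, 1) ∨ p = (1, 2) := by decide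
  set L : Finset (Fin 4 × Fin 4) :=
    Finset.univ.filter fun p : Fin 4 × Fin 4 => (p.1 = 0 ∨ p.1 = 1) ∧ p.2 ≠ 3 with hL
  have live_off : ∀ x : Fin 4 × Fin 4 → K, ((∀ j, x (2, j) = 0) ∧ (∀ j, x (3, j) = 0) ∧
      x (0, 3) = 0 ∧ x (1, 3) = 0) → ∀ p, p ∉ L → x p = 0 := by
    rintro x ⟨h2, h3, h03, h13⟩ ⟨i, j⟩ hp
    have hp' : ¬ ((i = 0 ∨ i = 1) ∧ j ≠ 3) := fun h =>
      hp (Finset.mem_filter.2 ⟨Finset.mem_univ _, h⟩)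
    rcases (by decide : ∀ i : Fin 4, i = 0 ∨ i = 1 ∨ i = 2 ∨ i = 3) i with rfl | rfl | rfl | rfl
    · have hj : j = 3 := by
        by_contra hj
        exact hp' ⟨Or.inl rfl, hj⟩
      rw [hj]; exact h03
    · have hj : j = 3 := by
        by_contra hj
        exact hp' ⟨Or.inr rfl, hj⟩
      rw [hj]; exact h13
    · exact h2 j
    · exact h3 j
  let C6 : Submodule K (Fin 4 × Fin 4 → K) :=
    Submodule.span K (Set.range fun e : ↥L => (Pi.single (e : Fin 4 × Fin 4) (1 : K) : Fin 4 × Fin 4 → K))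
  have hC6mem : ∀ x : Fin 4 × Fin 4 → K, (∀ p, p ∉ L → x p = 0) → x ∈ C6 := by
    intro x hx
    have hdecomp : x = ∑ p ∈ L, x p • (Pi.single p (1 : K) : Fin 4 × Fin 4 → K) :=
      calc x = ∑ p, (Pi.single p (x p) : Fin 4 × Fin 4 → K) := (Finset.univ_sum_single x).symm
        _ = ∑ p ∈ L, (Pi.single p (x p) : Fin 4 × Fin 4 → K) := by
          symm
          refine Finset.sum_subset (Finset.subset_univ L) fun p _ hp => ?_
          rw [hx p hp, Pi.single_zero]
        _ = ∑ p ∈ L, x p • (Pi.single p (1 : K) : Fin 4 × Fin 4 → K) :=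
          Finset.sum_congr rfl fun p _ => by
            ext q
            by_cases hq : q = p
            · subst hq; simp
            · simp [hq]
    rw [hdecomp]
    exact Submodule.sum_mem _ fun p hp =>
      Submodule.smul_mem _ _ (Submodule.subset_span ⟨⟨p, hp⟩, rfl⟩)
  have hli : LinearIndependent K (fun e : ↥L => (Pi.single (e : Fin 4 × Fin 4) (1 : K) : Fin 4 × Fin 4 → K)) := by
    have h := (Pi.basisFun K (Fin 4 × Fin 4)).linearIndependent
    have h' : LinearIndependent K (fun p : Fin 4 × Fin 4 => (Pi.single p (1 : K) : Fin 4 × Fin 4 → K)) := by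
      convert h using 1
      ext p q
      simp [Pi.basisFun_apply]
    exact h'.comp _ Subtype.val_injective
  have hC6rank : finrank K C6 = 6 := by
    rw [finrank_span_eq_card hli, Fintype.card_coe, hLcard]
  have hWC6 : W ≤ C6 := fun x hx => hC6mem x (live_off x (hWc x hx))
  obtain ⟨e, heL, heW⟩ : ∃ e ∈ L, (Pi.single e (1 : K) : Fin 4 × Fin 4 → K) ∉ W := by
    by_contra hall
    push Not at hall
    have hle : C6 ≤ W := Submodule.span_le.2 (by
      rintro _ ⟨e', rfl⟩
      exact hall e' e'.2)
    have h1 := Submodule.finrank_mono hle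
    rw [hC6rank, h5] at h1
    omega
  obtain ⟨φ, hφe, hφW⟩ := Submodule.exists_dual_map_eq_bot_of_notMem heW inferInstance
  have hφ0 : ∀ x ∈ W, φ x = 0 := fun x hx => by
    have h := Submodule.mem_map_of_mem (f := φ) hx
    rw [hφW, Submodule.mem_bot] at h
    exact h
  have hWmem : ∀ x : Fin 4 × Fin 4 → K, (∀ p, p ∉ L → x p = 0) → φ x = 0 → x ∈ W := by
    have hWle : W ≤ C6 ⊓ LinearMap.ker φ :=
      fun x hx => ⟨hWC6 hx, LinearMap.mem_ker.2 (hφ0 x hx)⟩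
    have hlt : C6 ⊓ LinearMap.ker φ < C6 := by
      refine lt_of_le_of_ne inf_le_left fun h => hφe ?_
      have heC : (Pi.single e (1 : K) : Fin 4 × Fin 4 → K) ∈ C6 := Submodule.subset_span ⟨⟨e, heL⟩, rfl⟩
      rw [← h] at heC
      exact LinearMap.mem_ker.1 heC.2
    have hlt' := Submodule.finrank_lt_finrank_of_lt hlt
    have hWeq : W = C6 ⊓ LinearMap.ker φ :=
      Submodule.eq_of_le_of_finrank_le hWle (by rw [hC6rank] at hlt'; omega)
    intro x hx hφx
    rw [hWeq]
    exact ⟨hC6mem x hx, LinearMap.mem_ker.2 hφx⟩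
  have hφx : ∀ x : Fin 4 × Fin 4 → K, ((∀ j, x (2, j) = 0) ∧ (∀ j, x (3, j) = 0) ∧
      x (0, 3) = 0 ∧ x (1, 3) = 0) →
      φ x = x (0, 0) * φ ((Pi.single (0, 0) (1 : K) : Fin 4 × Fin 4 → K)) + x (0, 1) * φ ((Pi.single (0, 1) (1 : K) : Fin 4 × Fin 4 → K)) +
        x (0, 2) * φ ((Pi.single (0, 2) (1 : K) : Fin 4 × Fin 4 → K)) + x (1, 0) * φ ((Pi.single (1, 0) (1 : K) : Fin 4 × Fin 4 → K)) +
        x (1, 1) * φ ((Pi.single (1, 1) (1 : K) : Fin 4 × Fin 4 → K)) + x (1, 2) * φ ((Pi.single (1, 2) (1 : K) : Fin 4 × Fin 4 → K)) := by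
    rintro x ⟨h2, h3, h03, h13⟩
    have hd := live_decomp x h2 h3 h03 h13
    conv_lhs => rw [hd]
    simp only [map_add, map_smul, smul_eq_mul]
  obtain ⟨θa, hθa⟩ : ∃ θa : Fin 4 → K, ∀ j, θa j = φ ((Pi.single (0, j) (1 : K) : Fin 4 × Fin 4 → K)) :=
    ⟨fun j => φ ((Pi.single (0, j) (1 : K) : Fin 4 × Fin 4 → K)), fun _ => rfl⟩
  obtain ⟨θb, hθb⟩ : ∃ θb : Fin 4 → K, ∀ j, θb j = φ ((Pi.single (1, j) (1 : K) : Fin 4 × Fin 4 → K)) :=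
    ⟨fun j => φ ((Pi.single (1, j) (1 : K) : Fin 4 × Fin 4 → K)), fun _ => rfl⟩
  refine ⟨θa, θb, ?_, fun x hx => ?_, fun x h2 h3 h03 h13 hS => ?_⟩
  · rintro ⟨h0, h1, h2, h3, h4, h5'⟩
    rw [hθa] at h0 h1 h2
    rw [hθb] at h3 h4 h5'
    rcases hLcases e heL with rfl | rfl | rfl | rfl | rfl | rfl
    exacts [hφe h0, hφe h1, hφe h2, hφe h3, hφe h4, hφe h5']
  · have h := hφx x (hWc x hx)
    rw [hφ0 x hx] at h
    rw [hθa, hθa, hθa, hθb, hθb, hθb]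
    linear_combination -h
  · refine hWmem x (live_off x ⟨h2, h3, h03, h13⟩) ?_
    rw [hφx x ⟨h2, h3, h03, h13⟩]
    rw [hθa, hθa, hθa, hθb, hθb, hθb] at hS
    linear_combination hS

/-- **The torus case.**  If `θ_a` or `θ_b` vanishes on the live columns, `W` is of torus type
`VTorusType` (`σ ∈ {1, (0 1)}`, `τ = 1`). [folklore] -/
theorem vTorusType_of_wcol_functional (W : Submodule K (Fin 4 × Fin 4 → K))
    (hWc : ∀ x ∈ W, (∀ j, x (2, j) = 0) ∧ (∀ j, x (3, j) = 0) ∧ x (0, 3) = 0 ∧ x (1, 3) = 0)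
    (θa θb : Fin 4 → K)
    (hθW : ∀ x ∈ W, θa 0 * x (0, 0) + θa 1 * x (0, 1) + θa 2 * x (0, 2) +
        (θb 0 * x (1, 0) + θb 1 * x (1, 1) + θb 2 * x (1, 2)) = 0)
    (hWθ : ∀ x : Fin 4 × Fin 4 → K, (∀ j, x (2, j) = 0) → (∀ j, x (3, j) = 0) → x (0, 3) = 0 →
      x (1, 3) = 0 → θa 0 * x (0, 0) + θa 1 * x (0, 1) + θa 2 * x (0, 2) +
        (θb 0 * x (1, 0) + θb 1 * x (1, 1) + θb 2 * x (1, 2)) = 0 → x ∈ W)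
    (hne : ¬ (θa 0 = 0 ∧ θa 1 = 0 ∧ θa 2 = 0 ∧ θb 0 = 0 ∧ θb 1 = 0 ∧ θb 2 = 0))
    (htor : (θa 0 = 0 ∧ θa 1 = 0 ∧ θa 2 = 0) ∨ (θb 0 = 0 ∧ θb 1 = 0 ∧ θb 2 = 0)) :
    VTorusType W := by
  classical
  have f3 : ∀ j : Fin 4, (j = 3) = (j = 3) := fun _ => rfl
  rcases htor with ⟨ha0, ha1, ha2⟩ | ⟨hb0, hb1, hb2⟩
  · -- `θ_a = 0`: the equation sits on row `1`; `σ = τ = 1`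
    obtain ⟨θ, hθ⟩ : ∃ θ : Fin 4 → K, ∀ j, θ j = if j = 3 then 0 else θb j :=
      ⟨fun j => if j = 3 then 0 else θb j, fun _ => rfl⟩
    have hθ0 : θ 0 = θb 0 := by rw [hθ, if_neg (by decide)]
    have hθ1 : θ 1 = θb 1 := by rw [hθ, if_neg (by decide)]
    have hθ2 : θ 2 = θb 2 := by rw [hθ, if_neg (by decide)]
    have hθ3 : θ 3 = 0 := by rw [hθ, if_pos rfl]
    refine ⟨Equiv.refl _, Equiv.refl _, θ, hθ3, fun h => hne ⟨ha0, ha1, ha2, ?_, ?_, ?_⟩, fun x => ?_⟩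
    · rw [← hθ0, h]; rfl
    · rw [← hθ1, h]; rfl
    · rw [← hθ2, h]; rfl
    simp only [Equiv.refl_apply, Fin.sum_univ_four, hθ0, hθ1, hθ2, hθ3, zero_mul, add_zero]
    constructor
    · intro hx
      obtain ⟨h2, h3, h03, h13⟩ := hWc x hx
      refine ⟨h2, h3, h03, h13, ?_⟩
      have h := hθW x hx
      rw [ha0, ha1, ha2] at h
      linear_combination h
    · rintro ⟨h2, h3, h03, h13, hS⟩
      refine hWθ x h2 h3 h03 h13 ?_
      rw [ha0, ha1, ha2]
      linear_combination hS
  · -- `θ_b = 0`: the equation sits on row `0`; `σ = (0 1)`, `τ = 1`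
    obtain ⟨θ, hθ⟩ : ∃ θ : Fin 4 → K, ∀ j, θ j = if j = 3 then 0 else θa j :=
      ⟨fun j => if j = 3 then 0 else θa j, fun _ => rfl⟩
    have hθ0 : θ 0 = θa 0 := by rw [hθ, if_neg (by decide)]
    have hθ1 : θ 1 = θa 1 := by rw [hθ, if_neg (by decide)]
    have hθ2 : θ 2 = θa 2 := by rw [hθ, if_neg (by decide)]
    have hθ3 : θ 3 = 0 := by rw [hθ, if_pos rfl]
    have s0 : Equiv.swap (0 : Fin 4) 1 0 = 1 := by decide
    have s1 : Equiv.swap (0 : Fin 4) 1 1 = 0 := by decide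
    have s2 : Equiv.swap (0 : Fin 4) 1 2 = 2 := by decide
    have s3 : Equiv.swap (0 : Fin 4) 1 3 = 3 := by decide
    refine ⟨Equiv.swap 0 1, Equiv.refl _, θ, hθ3, fun h => hne ⟨?_, ?_, ?_, hb0, hb1, hb2⟩,
      fun x => ?_⟩
    · rw [← hθ0, h]; rfl
    · rw [← hθ1, h]; rfl
    · rw [← hθ2, h]; rfl
    simp only [Equiv.refl_apply, s0, s1, s2, s3, Fin.sum_univ_four, hθ0, hθ1, hθ2, hθ3, zero_mul,
      add_zero]
    constructor
    · intro hx
      obtain ⟨h2, h3, h03, h13⟩ := hWc x hx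
      refine ⟨h2, h3, h13, h03, ?_⟩
      have h := hθW x hx
      rw [hb0, hb1, hb2] at h
      linear_combination h
    · rintro ⟨h2, h3, h13, h03, hS⟩
      refine hWθ x h2 h3 h03 h13 ?_
      rw [hb0, hb1, hb2]
      linear_combination hS

end Summit.ValiantsHypothesis.ValiantsHypothesis.Theorems.SymPencilPerFourWcolHyperplaneFiveTools
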